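import Literature.NumberTheory.Transcendental.AxSchanuel
import HarnessLib

/-!
# Ax–Schanuel for the Weierstrass `℘`-function (elliptic exponential), differential-field form

Topic `Literature/NumberTheory/Transcendental`; cite/fact item `wi-12121` (route
`KontsevichZagierPeriods/DimensionBudget`, crux `DimOneNotConservative`): the elliptic analogue of
the tree's `Literature.NumberTheory.Transcendental.ax_schanuel` (Ax 1971, Thm. 3), vendored as a
named fact from J. Kirby, *The theory of the exponential differential equations of semiabelian
varieties*, Selecta Math. 15 (2009) 445–486 (`Kirby2009`), Theorem 3.8, specialised to powers of an
elliptic curve in Weierstrass coordinates. Earlier sources for the elliptic / algebraic-group case: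
J. Ax, Amer. J. Math. 94 (1972), Thm. 1 (analytic subgroups of algebraic groups, complex-analytic
form) and W. D. Brownawell – K. K. Kubota, Acta Arith. 33 (1977) (Weierstrass functions), as
attributed by Kirby (§1) and by Pila, *Point-counting and the Zilber–Pink conjecture* (2022),
§13 ("The differential version in the semi-abelian setting is deduced in [Kirby 2009]").

**Kirby 2009, Theorem 3.8 (the Schanuel property).** "Let `F` be a field of characteristic zero,
let `Δ` be a collection of derivations on `F`, and let `C` be the intersection of their constant
fields. Let `S` be a semiabelian variety defined over `C`, of dimension `n`, and let `Γ_S ⊆ LS × S`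
be the solution set of the exponential differential equation of `S` (that is, the intersection of
the solution sets for each `D ∈ Δ`). Suppose that `(x, y) ∈ Γ_S` and
`td(x, y/C) − rk Jac(x, y) < n`. Then there is a proper algebraic subgroup `H` of `S` and a constant
point `γ ∈ TS(C)` such that `(x, y)` lies in the coset `γ · TH`." Here (Lemma 3.4)
`(x, y) ∈ Γ_S iff D^*ω_i(x, y) = 0` for `ω_i(x, y) = ζ_i(y) − ξ_i(x)`, `ζ_i` a basis of invariant
differentials of `S` and `ξ_i` the corresponding invariant differentials of `LS`; `Jac(x, y)` is the
matrix of all `D_j` applied to the coordinates of `(x, y)` (§3.2), `td(·/C)` the transcendence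
degree of `C(·)/C`.

## The specialisation vendored here (`S = Eⁿ`, Weierstrass coordinates)

Let `E : Y² = 4X³ − g₂X − g₃`, `g₂, g₃ ∈ C`, `g₂³ − 27g₃² ≠ 0`, an elliptic curve over `C`, with
invariant differential `ζ = dX/Y` and the coordinate `x` on `LE ≅ 𝔾ₐ` dual to it (`ξ = dx`). For an
affine point `y = (X, Y)` with `Y ≠ 0`, `D^*ζ(y) = DX/Y` and `D^*ξ(x) = Dx`, so
`(x, y) ∈ Γ_E ⟺ D X = Y · D x` for all `D ∈ Δ` — the exponential differential equation of `E`
("`X = ℘(x)`, `Y = ℘′(x)`": `d℘(x(t))/dt = ℘′(x(t)) x′(t)`); `Γ_{Eⁿ}` is the product condition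
(axiom U7). Then `td(x, y/C) = trdeg_C C(x_i, X_i, Y_i)`, and since `D_j X_i = Y_i D_j x_i` and
`D_j Y_i = (6X_i² − g₂/2) D_j x_i` (differentiate the Weierstrass equation), the columns of
`Jac(x, y)` belonging to `X_i, Y_i` are `F`-multiples of the column of `x_i`:
`rk Jac(x, y) = rk (D_j x_i)_{i,j}`. Finally, a proper algebraic subgroup `H` of `Eⁿ` lies in the
kernel of a non-zero homomorphism `φ = (α_1, …, α_n) : Eⁿ → E` (`α_i ∈ End E`), whose differential
is `(v_i) ↦ ∑ a_i v_i` with `a_i = dα_i` algebraic over `ℚ`, not all zero (characteristic `0`); so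
`(x, y) ∈ γ · TH` with `γ` constant forces `∑ a_i x_i = ∑ a_i γ_i` algebraic over `C`, and — `C`
being relatively algebraically closed in `F` (constants of derivations in characteristic `0`), so
that `F` and `C^{alg}` are linearly disjoint over `C` — a relation `∑ b_i x_i ∈ C` with
`b_i ∈ C` not all zero. Hence, contrapositively: **if `x_1, …, x_n` are `C`-linearly independent
modulo `C`, then `trdeg_C C(x, X, Y) ≥ n + rk (D_j x_i)`.** The hypothesis "`C`-linearly independent
modulo `C`" is stronger than Kirby's exact condition (independence over the multipliers `dEnd(E)`,
i.e. over `ℤ` for a curve without complex multiplication and over an imaginary-quadratic order with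
CM), so the vendored statement is WEAKER than the printed theorem and uniform in `E`; the affine
restriction `Y_i ≠ 0` (no `2`-torsion or infinite coordinates) is a further specialisation. Kirby
works inside an ambient algebraically closed field; for a general `F` one applies the theorem to
the algebraic closure with the unique extensions of the `D_j` (constants `C^{alg}`, same
transcendence degree and rank), which the argument above already accommodates.

## Contents

* `IsCLinearIndependentMod D x` — `C`-linear independence of `x_1, …, x_n` modulo `C`.
* `ax_schanuel_weierstrass : Prop` — the named fact, in the shape of `ax_schanuel`
  (`Algebra.trdeg` of the `C`-subalgebra generated by the `x_i, X_i, Y_i`, `Matrix.rank`).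
* API: `isCLinearIndependentMod_zero`, `IsCLinearIndependentMod.isQLinearIndependentMod`
  (`C`-independence implies the `ℚ`-independence of `AxSchanuel.lean`),
  `IsCLinearIndependentMod.not_mem` and the one-variable corollary
  `ax_schanuel_weierstrass.one` (`n = 1`: an elliptic logarithm `x ∉ C` of a point `(X, Y)` has
  `trdeg_C C(x, X, Y) ≥ 2`, the form used by the route).
-/

noncomputable section

namespace Literature.NumberTheory.Transcendental

open scoped BigOperators

/-! ### `C`-linear independence modulo constants -/

section Constants

variable {K : Type*} [CommRing K] {ι : Type*}

/-- `x_1, …, x_n` are **linearly independent over the constants `C` modulo `C`**: a combination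
`∑ a_i x_i` with constant coefficients `a_i ∈ C` lies in `C` only if all `a_i = 0`. This is the
uniform hypothesis under which no proper algebraic subgroup coset of `Eⁿ` can contain the point
(it implies independence over the multipliers of `End E`, which lie in `C^{alg}`).
[cite: Kirby2009, Thm. 3.8 (hypothesis, contrapositive form for S = Eⁿ)] -/
def IsCLinearIndependentMod (D : ι → Derivation ℤ K K) {n : ℕ} (x : Fin n → K) : Prop :=
  ∀ a : Fin n → K, (∀ i, a i ∈ constantSubring D) → (∑ i, a i * x i) ∈ constantSubring D → a = 0

/-- The empty family is vacuously `C`-independent modulo `C`. [folklore] -/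
theorem isCLinearIndependentMod_zero (D : ι → Derivation ℤ K K) (x : Fin 0 → K) :
    IsCLinearIndependentMod D x :=
  fun _ _ _ => funext fun i => i.elim0

/-- `C`-linear independence modulo `C` implies the `ℚ`-linear independence modulo `C` of
`AxSchanuel.lean` (integers are constants). [folklore] -/
theorem IsCLinearIndependentMod.isQLinearIndependentMod [CharZero K] {D : ι → Derivation ℤ K K}
    {n : ℕ} {x : Fin n → K} (h : IsCLinearIndependentMod D x) : IsQLinearIndependentMod D x := by
  intro q hq
  have hconst : ∀ i, ((q i : ℤ) : K) ∈ constantSubring D := fun i j => by simp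
  have := h (fun i => (q i : K)) hconst hq
  funext i
  have hi : ((q i : ℤ) : K) = 0 := congrFun this i
  show q i = 0
  exact_mod_cast hi

/-- No member of a `C`-independent family is a constant. [folklore] -/
theorem IsCLinearIndependentMod.not_mem {D : ι → Derivation ℤ K K} {n : ℕ} {x : Fin n → K}
    (h : IsCLinearIndependentMod D x) [Nontrivial K] (i₀ : Fin n) : x i₀ ∉ constantSubring D := by
  intro hx
  have hq := h (Pi.single i₀ 1) (fun i => by
      rcases eq_or_ne i i₀ with rfl | hne
      · simp [(constantSubring D).one_mem]
      · simp [hne, (constantSubring D).zero_mem]) (by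
    have : (∑ i, (Pi.single i₀ (1 : K) : Fin n → K) i * x i) = x i₀ := by
      rw [Finset.sum_eq_single i₀]
      · simp
      · intro b _ hb; simp [hb]
      · intro h; exact absurd (Finset.mem_univ i₀) h
    rw [this]; exact hx)
  have := congrFun hq i₀
  simp at this

/-- For a single element over a field, `C`-independence modulo `C` is just non-constancy. [folklore] -/
theorem isCLinearIndependentMod_one_iff {F : Type*} [Field F] {D : ι → Derivation ℤ F F} {x : Fin 1 → F} :
    IsCLinearIndependentMod D x ↔ x 0 ∉ constantSubring D := by
  refine ⟨fun h => h.not_mem 0, fun hx a ha hsum => ?_⟩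
  funext i
  obtain rfl : i = 0 := Subsingleton.elim _ _
  by_contra ha0
  apply hx
  have hsum' : a 0 * x 0 ∈ constantSubring D := by simpa using hsum
  have hinv : (a 0)⁻¹ ∈ constantSubring D := inv_mem_constantSubring (ha 0)
  have := (constantSubring D).mul_mem hinv hsum'
  rwa [← mul_assoc, inv_mul_cancel₀ ha0, one_mul] at this

end Constants

/-! ### The named fact -/

/-- **Ax–Schanuel for the Weierstrass `℘`-function (elliptic exponential differential equation),
after Kirby 2009, Thm. 3.8 with `S = Eⁿ`.** Let `K` be a field of characteristic `0` with
derivations `D_1, …, D_m` and constants `C = ⋂ ker D_j`; let `g₂, g₃ ∈ C` with `g₂³ − 27 g₃² ≠ 0`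
(an elliptic curve `E : Y² = 4X³ − g₂X − g₃` over `C`); let `x, X, Y : Fin n → K` with
`Y_i² = 4X_i³ − g₂X_i − g₃`, `Y_i ≠ 0`, and the exponential differential equation of `E`,
`D_j X_i = Y_i · D_j x_i` for all `i, j` ("`(X_i, Y_i) = (℘(x_i), ℘′(x_i))`"). If `x_1, …, x_n` are
`C`-linearly independent modulo `C`, then
`n + rank (D_j x_i)_{i,j} ≤ trdeg_C C[x, X, Y]`.
Derived from the printed Schanuel property (a proper-algebraic-subgroup coset would give a
`C`-linear relation among the `x_i` modulo `C`; `rk Jac(x, y) = rk (D_j x_i)`; see the module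
docstring), hence WEAKER than it: uniform in `E` (no `End E`), affine points with `Y_i ≠ 0` only.
Not in Mathlib; stated as a `Prop`. [cite: Kirby2009, Thm. 3.8 (S = Eⁿ in Weierstrass coordinates, with Lemma 3.4 and §3.2)] -/
def ax_schanuel_weierstrass : Prop :=
  ∀ (K : Type) [Field K] [CharZero K] (m n : ℕ) (D : Fin m → Derivation ℤ K K) (g₂ g₃ : K)
    (x X Y : Fin n → K),
    g₂ ∈ constantSubring D → g₃ ∈ constantSubring D → g₂ ^ 3 - 27 * g₃ ^ 2 ≠ 0 →
    (∀ i, Y i ^ 2 = 4 * X i ^ 3 - g₂ * X i - g₃) → (∀ i, Y i ≠ 0) →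
    (∀ j i, D j (X i) = Y i * D j (x i)) → IsCLinearIndependentMod D x →
      ((n + (Matrix.of fun i j => D j (x i)).rank : ℕ) : Cardinal) ≤
        Algebra.trdeg (constantSubring D)
          (Algebra.adjoin (constantSubring D) (Set.range x ∪ Set.range X ∪ Set.range Y))

/-! ### API -/

/-- A `1 × m` matrix with a non-zero entry has rank at least `1`. [folklore] -/
theorem one_le_rank_of_ne_zero {K : Type*} [Field K] {m : ℕ} (v : Fin 1 → Fin m → K) {j₀ : Fin m}
    (h : v 0 j₀ ≠ 0) : 1 ≤ (Matrix.of v).rank := by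
  by_contra hlt
  have h0 : (Matrix.of v).rank = 0 := by omega
  have hrange : LinearMap.range (Matrix.of v).mulVecLin = ⊥ := by
    have := Matrix.rank_eq_finrank_range_toLin (Matrix.of v) (Pi.basisFun K (Fin 1))
      (Pi.basisFun K (Fin m))
    rw [h0] at this
    exact Submodule.finrank_eq_zero.1 (by
      rw [Matrix.rank] at h0
      exact h0)
  have hcol : (Matrix.of v).mulVecLin (Pi.single j₀ 1) = 0 := by
    have hmem : (Matrix.of v).mulVecLin (Pi.single j₀ 1) ∈ LinearMap.range (Matrix.of v).mulVecLin :=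
      LinearMap.mem_range_self _ _
    rw [hrange, Submodule.mem_bot] at hmem
    exact hmem
  have := congrFun hcol 0
  simp [Matrix.mulVec, dotProduct, Pi.single_apply] at this
  exact h this

/-- **The one-variable case used by the route** (`n = 1`): if `x ∉ C` is an "elliptic logarithm" of
the affine point `(X, Y)` of `E : Y² = 4X³ − g₂X − g₃` (`g₂, g₃ ∈ C`, `Y ≠ 0`,
`D_j X = Y · D_j x` for all `j`), then `trdeg_C C[x, X, Y] ≥ 2`; since `Y` is algebraic over `C(X)`
this says that `x` is transcendental over `C(X, Y)`. [cite: Kirby2009, Thm. 3.8 (S = E, n = 1)] -/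
theorem ax_schanuel_weierstrass.one (hAS : ax_schanuel_weierstrass) (K : Type) [Field K] [CharZero K]
    (m : ℕ) (D : Fin m → Derivation ℤ K K) (g₂ g₃ x X Y : K)
    (hg₂ : g₂ ∈ constantSubring D) (hg₃ : g₃ ∈ constantSubring D) (hΔ : g₂ ^ 3 - 27 * g₃ ^ 2 ≠ 0)
    (hE : Y ^ 2 = 4 * X ^ 3 - g₂ * X - g₃) (hY : Y ≠ 0) (hexp : ∀ j, D j X = Y * D j x)
    (hx : x ∉ constantSubring D) :
    (2 : Cardinal) ≤ Algebra.trdeg (constantSubring D)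
      (Algebra.adjoin (constantSubring D) ({x, X, Y} : Set K)) := by
  have hind : IsCLinearIndependentMod D (fun _ : Fin 1 => x) :=
    isCLinearIndependentMod_one_iff.2 hx
  have h := hAS K m 1 D g₂ g₃ (fun _ => x) (fun _ => X) (fun _ => Y) hg₂ hg₃ hΔ (fun _ => hE)
    (fun _ => hY) (fun j _ => hexp j) hind
  -- some `D j x ≠ 0` since `x ∉ C`
  obtain ⟨j₀, hj₀⟩ : ∃ j, D j x ≠ 0 := by
    by_contra hall
    exact hx fun j => by_contra fun hj => hall ⟨j, hj⟩
  have hrank : 1 ≤ (Matrix.of fun (_ : Fin 1) j => D j x).rank :=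
    one_le_rank_of_ne_zero (fun _ j => D j x) hj₀
  have hset : (Set.range (fun _ : Fin 1 => x) ∪ Set.range (fun _ : Fin 1 => X) ∪
      Set.range (fun _ : Fin 1 => Y) : Set K) = {x, X, Y} := by
    ext z
    simp only [Set.range_const, Set.union_singleton, Set.mem_insert_iff, Set.mem_singleton_iff]
    tauto
  rw [hset] at h
  calc (2 : Cardinal) ≤ ((1 + (Matrix.of fun (_ : Fin 1) j => D j x).rank : ℕ) : Cardinal) := by
        exact_mod_cast (by omega : 2 ≤ 1 + (Matrix.of fun (_ : Fin 1) j => D j x).rank)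
    _ ≤ _ := h

end Literature.NumberTheory.Transcendental
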